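import Mathlib
import HarnessLib
import Summits.ValiantsHypothesis.ValiantsHypothesis.Theses.MonotoneRestoration
import Literature.Computability.AlgebraicComplexity.ArithCircuitProofs
import Literature.Computability.AlgebraicComplexity.RazElusiveGeneralRouteProofs
import Literature.Computability.AlgebraicComplexity.ValiantConjectureEquivProofs

/-!
# ValiantsHypothesis / MonotoneRestoration — `MonotoneRestorationQP`, line `Sketch`, wave 3

Support file for crux item `stmt-ValiantsHypothesis-15886`
(`Summit.ValiantsHypothesis.ValiantsHypothesis.Theses.MonotoneRestoration.MonotoneRestorationQP`),
line `Sketch`, stub `stub_vh_implies_nonInjective_monotoneHard`.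

FACT 0. The "non-injective maps" polynomial
`NI n = ∑ ψ : Fin n → Fin n, (if Injective ψ then 0 else ∏ i, X (i, ψ i))`
satisfies, over every commutative semiring, `NI n + per n = ∏ i, ∑ j, X (i, j)`
(`nonInjective_add_perPoly`): split the expansion of the product of the row sums according to
whether the choice function `ψ` is injective, and identify injective self-maps of `Fin n` with
permutations. Consequently Valiant's hypothesis ALONE predicts that `NI` is monotone-hard: a
monotone (`ℝ≥0`) circuit of size `(n+2)^c` for `NI n` is a circuit over `ℂ` for its
complexification (`ArithCircuit.complexity_map_le`), whence
`per n = ∏ i, ∑ j, X (i, j) + (-1) • NI n` gets circuits of polynomial size over `ℂ`, i.e. the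
permanent family is p-computable, i.e. `VP ℂ = VNP ℂ` (`isPComputable_perPoly_complex_iff`,
von zur Gathen 1987 Prop. 4.8 / Bürgisser 2000 Rem. 2.11, proved in the tree).

No new definitions: the family is written as the literal sum everywhere.
-/

-- `Summit.ValiantsHypothesis.ValiantsHypothesis.…` is the tree's mandated single-conjunct layout
-- (Sub = Summit), so the duplicated namespace component is intended.
set_option linter.dupNamespace false

namespace Summit.ValiantsHypothesis.ValiantsHypothesis.Theorems

open Summit.ValiantsHypothesis.ValiantsHypothesis.Theses.MonotoneRestoration
open Literature.Computability.AlgebraicComplexity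

/-- The generic permanent as a sum over permutations of ROW-indexed products,
`per = ∑ σ, ∏ i, X (i, σ i)` (transpose of Mathlib's column-indexed `Matrix.permanent`).
[folklore] -/
theorem perPoly_eq_sum_perm_rowProd (n : ℕ) (R : Type*) [CommSemiring R] :
    perPoly (Fin n) R =
      ∑ σ : Equiv.Perm (Fin n), ∏ i : Fin n, (MvPolynomial.X (i, σ i) : MvPolynomial _ R) := by
  rw [perPoly, ← Matrix.permanent_transpose]
  simp [Matrix.permanent, Matrix.transpose_apply, Matrix.mvPolynomialX_apply]

/-- On a finite type the injective self-maps are the permutations: a sum over `Equiv.Perm (Fin n)`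
is the sum over the injective `ψ : Fin n → Fin n` of the same function of the underlying map.
[folklore] -/
theorem sum_perm_eq_sum_filter_injective' {n : ℕ} {M : Type*} [AddCommMonoid M]
    (F : (Fin n → Fin n) → M) :
    ∑ σ : Equiv.Perm (Fin n), F σ =
      ∑ ψ ∈ (Finset.univ : Finset (Fin n → Fin n)).filter (fun ψ => Function.Injective ψ), F ψ := by
  rw [Finset.sum_subtype ((Finset.univ : Finset (Fin n → Fin n)).filter
      (fun ψ => Function.Injective ψ)) (p := fun ψ => Function.Injective ψ) (by simp)]
  refine Fintype.sum_bijective (fun σ => ⟨σ, σ.injective⟩) ⟨?_, ?_⟩ _ _ (fun σ => rfl)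
  · intro σ τ hστ
    exact Equiv.ext (congrFun (congrArg Subtype.val hστ))
  · rintro ⟨ψ, hψ⟩
    exact ⟨Equiv.ofBijective ψ (Finite.injective_iff_bijective.1 hψ), rfl⟩

/-- **Fact 0** (any commutative semiring): `NI n + per n = ∏ i, ∑ j, X (i, j)` — expanding the
product of the row sums gives `∑_{ψ : Fin n → Fin n} ∏ i, X (i, ψ i)` (`Fintype.prod_sum`); the
injective `ψ` contribute the permanent, the non-injective ones `NI n`. [folklore] -/
theorem nonInjective_add_perPoly (n : ℕ) (R : Type*) [CommSemiring R] :
    (∑ ψ : Fin n → Fin n, if Function.Injective ψ then (0 : MvPolynomial (Fin n × Fin n) R)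
        else ∏ i : Fin n, MvPolynomial.X (i, ψ i)) + perPoly (Fin n) R =
      ∏ i : Fin n, ∑ j : Fin n, MvPolynomial.X (i, j) := by
  rw [perPoly_eq_sum_perm_rowProd,
    sum_perm_eq_sum_filter_injective' (fun ψ : Fin n → Fin n =>
      ∏ i : Fin n, (MvPolynomial.X (i, ψ i) : MvPolynomial (Fin n × Fin n) R)),
    Finset.sum_ite, Finset.sum_const_zero, zero_add, Finset.sum_filter_not_add_sum_filter,
    Fintype.prod_sum]

/-- **Fact 0 over `ℂ`, complexified**: with `φ : ℝ≥0 → ℝ → ℂ`,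
`map φ (NI n) + per n = ∏ i, ∑ j, X (i, j)` in `ℂ[x_ij]`. [folklore] -/
theorem map_nonInjective_add_perPoly (n : ℕ) :
    MvPolynomial.map (Complex.ofRealHom.comp NNReal.toRealHom)
        (∑ ψ : Fin n → Fin n, if Function.Injective ψ then (0 : MvPolynomial (Fin n × Fin n) NNReal)
          else ∏ i : Fin n, MvPolynomial.X (i, ψ i)) + perPoly (Fin n) ℂ =
      ∏ i : Fin n, ∑ j : Fin n, MvPolynomial.X (i, j) := by
  have hmap : MvPolynomial.map (Complex.ofRealHom.comp NNReal.toRealHom)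
      (∑ ψ : Fin n → Fin n, if Function.Injective ψ then (0 : MvPolynomial (Fin n × Fin n) NNReal)
        else ∏ i : Fin n, MvPolynomial.X (i, ψ i)) =
      ∑ ψ : Fin n → Fin n, if Function.Injective ψ then (0 : MvPolynomial (Fin n × Fin n) ℂ)
        else ∏ i : Fin n, MvPolynomial.X (i, ψ i) := by
    simp only [map_sum, apply_ite, map_zero, map_prod, MvPolynomial.map_X]
  rw [hmap, nonInjective_add_perPoly]

/-- Subtraction costs two gates: if `f + g = h` over a commutative ring then
`L(g) = L(h + (-1) • f) ≤ L(h) + (L(f) + 1) + 1` (Bürgisser 2000, §2.1). [folklore] -/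
theorem complexity_le_of_add_eq {k : Type*} [CommRing k] {σ : Type*}
    (f g h : MvPolynomial σ k) (hfg : f + g = h) :
    complexity g ≤ complexity h + (complexity f + 1) + 1 := by
  have hg : g = h + (-1 : k) • f := by
    rw [← hfg, neg_one_smul, ← sub_eq_add_neg, add_sub_cancel_left]
  rw [hg]
  calc complexity (h + (-1 : k) • f)
      ≤ complexity h + complexity ((-1 : k) • f) + 1 := complexity_add_le_holds _ _
    _ ≤ complexity h + (complexity f + 1) + 1 := by
        gcongr
        exact complexity_smul_le_holds _ _

/-- The product of the row sums `∏ i, ∑ j, X (i, j)` has circuits of size `≤ n·n + n`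
(`n` sum gates per row, `n` product gates; variables are free). [folklore] -/
theorem complexity_prod_rowSum_le (n : ℕ) (k : Type*) [CommSemiring k] :
    complexity (∏ i : Fin n, ∑ j : Fin n, (MvPolynomial.X (i, j) : MvPolynomial (Fin n × Fin n) k))
      ≤ n * n + n := by
  calc complexity (∏ i : Fin n, ∑ j : Fin n,
        (MvPolynomial.X (i, j) : MvPolynomial (Fin n × Fin n) k))
      ≤ ∑ i : Fin n, complexity (∑ j : Fin n,
          (MvPolynomial.X (i, j) : MvPolynomial (Fin n × Fin n) k)) +
          (Finset.univ : Finset (Fin n)).card := complexity_finset_prod_le _ _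
    _ ≤ ∑ _i : Fin n, n + (Finset.univ : Finset (Fin n)).card := by
        gcongr with i _
        calc complexity (∑ j : Fin n, (MvPolynomial.X (i, j) : MvPolynomial (Fin n × Fin n) k))
            ≤ ∑ j : Fin n, complexity (MvPolynomial.X (i, j) : MvPolynomial (Fin n × Fin n) k) +
                (Finset.univ : Finset (Fin n)).card := complexity_finset_sum_le _ _
          _ = n := by
              have hX : ∀ j : Fin n,
                  complexity (MvPolynomial.X (i, j) : MvPolynomial (Fin n × Fin n) k) = 0 :=
                fun j => complexity_X_holds _
              simp [hX]
    _ = n * n + n := by simp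

/-- Crude arithmetic: `n·n + n + ((n+2)^c + 1) + 1 ≤ (n+2)^(c+3)`. [folklore] -/
theorem vhImpliesNIHard_arith (n c : ℕ) :
    n * n + n + ((n + 2) ^ c + 1) + 1 ≤ (n + 2) ^ (c + 3) := by
  have h1 : n * n + n + 2 ≤ (n + 2) ^ 2 := by nlinarith
  have h2 : (n + 2) ^ 2 ≤ (n + 2) ^ (c + 2) :=
    Nat.pow_le_pow_right (by omega) (by omega)
  have h3 : (n + 2) ^ c ≤ (n + 2) ^ (c + 2) :=
    Nat.pow_le_pow_right (by omega) (by omega)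
  have h4 : 2 * (n + 2) ^ (c + 2) ≤ (n + 2) ^ (c + 3) :=
    calc 2 * (n + 2) ^ (c + 2) ≤ (n + 2) * (n + 2) ^ (c + 2) :=
          Nat.mul_le_mul_right _ (by omega)
      _ = (n + 2) ^ (c + 3) := by ring
  omega

/-- Arithmetic: `(n + 2)^c ≤ n^(2c + 3^c) + (2c + 3^c)` for all `n, c` — the `(n+2)^c` shape
rewritten in the `n^c' + c'` shape of `IsPBounded` (same statement as
`targetImpliesCrux_pow_bound` of the sibling module `MonotoneRestorationTargetImpliesCrux`,
repeated privately to keep this file's imports independent of it). [folklore] -/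
private theorem vhImpliesNIHard_pow_bound (n c : ℕ) :
    (n + 2) ^ c ≤ n ^ (2 * c + 3 ^ c) + (2 * c + 3 ^ c) := by
  rcases Nat.lt_or_ge n 2 with hn | hn
  · calc (n + 2) ^ c ≤ 3 ^ c := Nat.pow_le_pow_left (by omega) c
      _ ≤ 2 * c + 3 ^ c := Nat.le_add_left _ _
      _ ≤ n ^ (2 * c + 3 ^ c) + (2 * c + 3 ^ c) := Nat.le_add_left _ _
  · have h1 : n + 2 ≤ n * n := by nlinarith
    calc (n + 2) ^ c ≤ (n * n) ^ c := Nat.pow_le_pow_left h1 c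
      _ = n ^ (2 * c) := by rw [← pow_two, ← pow_mul]
      _ ≤ n ^ (2 * c + 3 ^ c) := Nat.pow_le_pow_right (by omega) (Nat.le_add_right _ _)
      _ ≤ n ^ (2 * c + 3 ^ c) + (2 * c + 3 ^ c) := Nat.le_add_right _ _

/-- **Polynomial circuits for the permanent from monotone circuits for `NI`.** If `NI n` has
monotone complexity `≤ (n+2)^c` then `per n ∈ ℂ[x_ij]` has complexity `≤ (n+2)^(c+3)`:
`per n = ∏ i, ∑ j, X (i, j) + (-1) • map φ (NI n)` and mapping a circuit along `φ : ℝ≥0 → ℂ`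
does not increase its size (`ArithCircuit.complexity_map_le`). [folklore] -/
theorem complexity_perPoly_le_of_nonInjective (c n : ℕ)
    (hc : complexity (k := NNReal)
      (∑ ψ : Fin n → Fin n, if Function.Injective ψ then (0 : MvPolynomial (Fin n × Fin n) NNReal)
        else ∏ i : Fin n, MvPolynomial.X (i, ψ i)) ≤ (n + 2) ^ c) :
    complexity (perPoly (Fin n) ℂ) ≤ (n + 2) ^ (c + 3) := by
  have hmapc : complexity (MvPolynomial.map (Complex.ofRealHom.comp NNReal.toRealHom)
      (∑ ψ : Fin n → Fin n, if Function.Injective ψ then (0 : MvPolynomial (Fin n × Fin n) NNReal)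
        else ∏ i : Fin n, MvPolynomial.X (i, ψ i))) ≤ (n + 2) ^ c :=
    (ArithCircuit.complexity_map_le _ _).trans hc
  calc complexity (perPoly (Fin n) ℂ)
      ≤ complexity (∏ i : Fin n, ∑ j : Fin n,
            (MvPolynomial.X (i, j) : MvPolynomial (Fin n × Fin n) ℂ)) +
          (complexity (MvPolynomial.map (Complex.ofRealHom.comp NNReal.toRealHom)
            (∑ ψ : Fin n → Fin n, if Function.Injective ψ then
              (0 : MvPolynomial (Fin n × Fin n) NNReal)
              else ∏ i : Fin n, MvPolynomial.X (i, ψ i))) + 1) + 1 :=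
        complexity_le_of_add_eq _ _ _ (map_nonInjective_add_perPoly n)
    _ ≤ (n * n + n) + ((n + 2) ^ c + 1) + 1 := by
        gcongr
        exact complexity_prod_rowSum_le n ℂ
    _ ≤ (n + 2) ^ (c + 3) := vhImpliesNIHard_arith n c

/-- W3a (**VH ⇒ `NI` is monotone-hard**). If Valiant's hypothesis `VP ℂ ≠ VNP ℂ` holds, then the
non-injective-maps polynomials `NI n` have no monotone (`ℝ≥0`) circuits of size `(n+2)^c`:
otherwise Fact 0 gives the permanent polynomial-size circuits over `ℂ`
(`complexity_perPoly_le_of_nonInjective`), i.e. the permanent family is p-computable, which over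
`ℂ` is equivalent to `VP ℂ = VNP ℂ` (`isPComputable_perPoly_complex_iff`; von zur Gathen 1987,
Prop. 4.8; Bürgisser 2000, Rem. 2.11). [folklore] -/
theorem stub_vh_implies_nonInjective_monotoneHard : _root_.ValiantsHypothesis →
    ¬ ∃ c : ℕ, ∀ n : ℕ, complexity (k := NNReal)
      (∑ ψ : Fin n → Fin n, if Function.Injective ψ then (0 : MvPolynomial (Fin n × Fin n) NNReal)
        else ∏ i : Fin n, MvPolynomial.X (i, ψ i)) ≤ (n + 2) ^ c := by
  rintro hVH ⟨c, hc⟩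
  apply hVH
  show VP ℂ = VNP ℂ
  rw [← isPComputable_perPoly_complex_iff]
  refine ⟨2 * (c + 3) + 3 ^ (c + 3), fun n => ?_⟩
  exact (complexity_perPoly_le_of_nonInjective c n (hc n)).trans
    (vhImpliesNIHard_pow_bound n (c + 3))

end Summit.ValiantsHypothesis.ValiantsHypothesis.Theorems
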